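import Summits.CriticalPhenomena.CardyFormulaZ2.Theorems.CardyUniqueLimitCardyRigidityDriverInputs
import HarnessLib

/-!
# Tightness of the running maxima of the discrete driving processes from box tightness
(line `crossing-martingale`, crux `CardyRigidity`, stub A2 `stub_percDrivingTail`)

Crux `Summit.CriticalPhenomena.CardyFormulaZ2.Theses.CardyUniqueLimit.CardyRigidity`
(stmt-CriticalPhenomena-0746), line `crossing_martingale`, stub A2 `stub_percDrivingTail`
(`∀ D E, ZdDiscretisationFamily D E → Driver.PercDrivingTail D E`: eventually-uniform
SUB-EXPONENTIAL tails of `sup_{u ≤ t} |drivingFunction φ_k (bondInterfaceIn D (E δ_k)) u|`,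
Kemppainen–Smirnov's Prop. 3.8 (1) for the bond-`ℤ²` exploration).

What the hypotheses of `Driver.PercDrivingTail` give by themselves is recorded here: the
box-tightness clause (with probability `≥ 1 - ε`, at every scale, the interface is the
compactified image `⟦Φ_k ∘ γ̂⟧` of a Loewner pair `(γ̂, W)` with `W ∈ Process.modulusSet {0} δW`)
bounds the running maxima UNIFORMLY IN THE SCALE but WITHOUT A RATE:

* `exists_forall_abs_le_of_mem_modulusSet` — a path of the box `Process.modulusSet {0} δW` is
  bounded on `[0, t]` by a constant `L(δW, t)` (chain along the modulus,
  `Process.dist_apply_zero_le_of_modulus'`);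
* `measure_exists_lt_abs_drivingFunction_le_of_pairBox` — for ANY random curve class `Y` and
  chordal `φ`, `P{∃ u ≤ t, a < |drivingFunction φ (Y ω) u|} ≤ P{Y ∉ ⟦Φ ∘ ·⟧ '' box}` once
  `a ≥ L(δW, t)`: on the box the Loewner transform of `⟦Φ ∘ γ̂⟧` IS `W`
  (`drivingFunction_compactifiedClass`, the pair being transient);
* `percDrivingTight`, `tail_percDrivingTight` — hence, for the bond-`ℤ²` interfaces read
  through approximating chordal maps `φ_k` with box tightness, for every `t` and `ε > 0` there
  is `n₀` with `P_{1/2}{∃ u ≤ t, n < |drivingFunction φ_k (bondInterfaceIn D (E δ_k)) u|} ≤ ε`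
  for all `n ≥ n₀` and ALL `k` (uniform tightness of the running maxima; the registered-shape
  statement `tail_percDrivingTight` carries the hypotheses of `Driver.PercDrivingTail` verbatim
  and replaces its conclusion by this one).

The exponential RATE of `Driver.PercDrivingTail` (or any summable rate) is NOT a consequence of
box tightness: it is Kemppainen–Smirnov's Prop. 3.7 ⟹ 3.8, whose input is Condition G2 for the
family — for the exploration read in `ℍ`, the boundary-annulus crossing bound `hG` of
`KSRectangleExit.measure_reach_abs_re_le` for the laws of the pulled-back interfaces, i.e. the
Russo–Seymour–Welsh theory of the bond-`ℤ²` exploration transported through the `φ_k`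
(KS §2.2, §3.3), which the tree does not have.  What the driver half
(`Driver.exists_regularDriver_perc`) really consumes of a tail clause is only the `L³`
integrability of the running maximum of the LIMIT; the weakest clause on the discrete processes
feeding it through the portmanteau theorem is a tail sequence `B n` at integer levels with
`∑ (n+2)³ B n < ∞`: `memLp_natCast_of_measure_lt_abs_le_of_tsum_ne_top` and
`exists_memLp_forall_abs_le_of_tendstoInDistribution_of_tsum_ne_top` below (the tree's
`Process.exists_memLp_forall_abs_le_of_tendstoInDistribution` is the case `B n = K e^{-c n}`,
`n ≥ n₀`).

References: A. Kemppainen, S. Smirnov, Ann. Probab. 45 (2017), §3.3 Prop. 3.7–3.8, §3.5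
(arXiv:1212.6215); P. Billingsley, Convergence of Probability Measures (1999), Thm. 2.1.
-/

noncomputable section

open MeasureTheory Filter Set Topology Metric
open scoped NNReal ENNReal
open UpperHalfPlane (upperHalfPlaneSet)
open Literature.Probability Literature.Probability.RandomPlanarGeometry
  Literature.Probability.LatticeModels Literature.Probability.Percolation
open scoped Literature.Probability.RandomPlanarGeometry.PathBorel

namespace Summit.CriticalPhenomena.CardyFormulaZ2.Cruxes.CardyRigidity.CrossingMartingale

namespace Driver

/-! ### Paths of a Kemppainen–Smirnov box are bounded on compact time intervals -/

/-- **A path of the box `Process.modulusSet {0} δW` is bounded on `[0, t]`** by a constant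
depending only on `(δW, t)`: with `m = ⌈t⌉`, chaining the modulus "`|s - s'| ≤ δW m ⟹
|x s - x s'| ≤ 1/(m+1)` on `[0, m+1]`" from `x 0 = 0` gives
`|x u| ≤ ((m+1)/δW m + 1)/(m+1)` for `u ≤ t` (`Process.dist_apply_zero_le_of_modulus'`).
[folklore] -/
theorem exists_forall_abs_le_of_mem_modulusSet {δW : ℕ → ℝ} (hδW : ∀ j, 0 < δW j) (t : ℝ≥0) :
    ∃ L : ℝ, ∀ x : C(ℝ≥0, ℝ), x ∈ Process.modulusSet ({0} : Set ℝ) δW →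
      ∀ u : ℝ≥0, u ≤ t → |x u| ≤ L := by
  set m : ℕ := ⌈(t : ℝ)⌉₊ with hm
  refine ⟨(((m : ℝ) + 1) / δW m + 1) * (1 / ((m : ℝ) + 1)), fun x hx u hu ↦ ?_⟩
  have h0 : x 0 = 0 := hx.1
  have hut : ((u : ℝ≥0) : ℝ) ≤ (m : ℝ) + 1 := by
    have h1 : ((u : ℝ≥0) : ℝ) ≤ (t : ℝ) := by exact_mod_cast hu
    have h2 : ((t : ℝ≥0) : ℝ) ≤ (m : ℝ) := Nat.le_ceil _
    linarith
  have h := Process.dist_apply_zero_le_of_modulus' (x : ℝ≥0 → ℝ) (T := (m : ℝ) + 1)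
    (hδW m) (by positivity) (fun s s' hs hs' hss' ↦ hx.2 m s s' hs hs' hss') hut
  rwa [h0, Real.dist_eq, zero_sub, abs_neg] at h

/-! ### The running maximum of the Loewner transform on a box event -/

/-- **Box tightness bounds the running maxima of the Loewner transforms, uniformly but without
rate.** Let `Y` be a random curve class on `(Ω, P)`, `φ` a chordal uniformizing map of the
Dobrushin domain `(D; a, b)` with boundary extension `Φ`, and suppose the event "`Y` is NOT the
compactified image `⟦Φ ∘ γ̂⟧` of a Loewner pair `(γ̂, W)` of the box with moduli `δγ`, `δW` and
transience profile `T`" has probability `≤ ε`.  If every path of `Process.modulusSet {0} δW` is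
bounded by `L` on `[0, t]`, then for every level `a ≥ L`,
`P{∃ u ≤ t, a < |drivingFunction φ (Y ω) u|} ≤ ε`: on the box event `Y ω = ⟦Φ ∘ γ̂⟧` with
`(γ̂, W)` transient, so `drivingFunction φ (Y ω) = W` (`drivingFunction_compactifiedClass`) and
`|W u| ≤ L ≤ a`. [cite: KemppainenSmirnov2017, §3.5] -/
theorem measure_exists_lt_abs_drivingFunction_le_of_pairBox {Ω : Type*} [MeasurableSpace Ω]
    (P : Measure Ω) {D : DobrushinDomain} {φ : ConformalEquiv upperHalfPlaneSet D.carrier}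
    (hφ : D.IsChordalUniformizing φ) (Y : Ω → CurveClass ℂ) {δγ δW : ℕ → ℝ} {T : ℕ → ℝ≥0}
    {ε : ℝ≥0∞}
    (hbox : P (Y ⁻¹' ((fun p ↦ compactifiedClass φ.boundaryExtension (D.pt 1) p.1) ''
      {p : C(ℝ≥0, ℂ) × C(ℝ≥0, ℝ) | p ∈ generatedPairs ∧
        p.1 ∈ Process.modulusSet ({0} : Set ℂ) δγ ∧ p.2 ∈ Process.modulusSet ({0} : Set ℝ) δW ∧
        ∀ (j : ℕ) (t : ℝ≥0), T j ≤ t → (j : ℝ) ≤ ‖p.1 t‖})ᶜ) ≤ ε)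
    {t : ℝ≥0} {L : ℝ}
    (hL : ∀ x : C(ℝ≥0, ℝ), x ∈ Process.modulusSet ({0} : Set ℝ) δW → ∀ u : ℝ≥0, u ≤ t → |x u| ≤ L)
    {a : ℝ} (ha : L ≤ a) :
    P {ω | ∃ u, u ≤ t ∧ a < |drivingFunction φ (Y ω) u|} ≤ ε := by
  refine le_trans (measure_mono fun ω hω ↦ ?_) hbox
  obtain ⟨u, hu, hau⟩ := hω
  rintro ⟨p, hp, hpY⟩
  have htr : Tendsto (fun s ↦ ‖p.1 s‖) atTop atTop :=
    tendsto_atTop_atTop.2 fun r ↦ ⟨T ⌈r⌉₊, fun s hs ↦ (Nat.le_ceil r).trans (hp.2.2.2 _ s hs)⟩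
  have hW : drivingFunction φ (Y ω) = p.2 := by
    rw [← hpY]
    exact drivingFunction_compactifiedClass hφ hp.1 htr
  have hbd := hL p.2 hp.2.2.1 u hu
  rw [hW] at hau
  exact absurd (hbd.trans ha) (not_le.2 hau)

/-! ### The bond-`ℤ²` interfaces through approximating maps -/

/-- **Uniform tightness of the running maxima of the discrete capacity driving processes of the
bond-`ℤ²` interfaces** read through chordal maps `φ_k` of approximating Dobrushin domains `D_k`
under which they are box-tight: for every `t` and `ε > 0` there is `n₀` with
`P_{1/2}{∃ u ≤ t, n < |drivingFunction φ_k (bondInterfaceIn D (E δ_k)) u|} ≤ ε` for all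
`n ≥ n₀` and ALL `k`.  (What the box-tightness output of Kemppainen–Smirnov's Prop. 3.2 gives for
the capacity event `E₁` of §3.5; no rate.) [cite: KemppainenSmirnov2017, §3.5] -/
theorem percDrivingTight {D : DobrushinDomain} {E : ℝ → DiscreteDobrushin} {δs : ℕ → ℝ}
    {Ds : ℕ → DobrushinDomain} {φs : ∀ k, ConformalEquiv upperHalfPlaneSet (Ds k).carrier}
    (hφs : ∀ k, (Ds k).IsChordalUniformizing (φs k))
    (hbox : ∀ ε : ℝ≥0∞, 0 < ε → ∃ (δγ δW : ℕ → ℝ) (T : ℕ → ℝ≥0), (∀ j, 0 < δγ j) ∧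
      (∀ j, 0 < δW j) ∧
      ∀ k, bondPercolation (zdGraph 2) half ((bondInterfaceIn D (E (δs k))) ⁻¹'
        ((fun p ↦ compactifiedClass (φs k).boundaryExtension ((Ds k).pt 1) p.1) ''
          {p : C(ℝ≥0, ℂ) × C(ℝ≥0, ℝ) | p ∈ generatedPairs ∧
            p.1 ∈ Process.modulusSet ({0} : Set ℂ) δγ ∧
            p.2 ∈ Process.modulusSet ({0} : Set ℝ) δW ∧
            ∀ (j : ℕ) (t : ℝ≥0), T j ≤ t → (j : ℝ) ≤ ‖p.1 t‖})ᶜ) ≤ ε)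
    (t : ℝ≥0) {ε : ℝ≥0∞} (hε : 0 < ε) :
    ∃ n₀ : ℕ, ∀ n : ℕ, n₀ ≤ n → ∀ k,
      bondPercolation (zdGraph 2) half {ω | ∃ u, u ≤ t ∧
        (n : ℝ) < |drivingFunction (φs k) (bondInterfaceIn D (E (δs k)) ω) u|} ≤ ε := by
  obtain ⟨δγ, δW, T, -, hδW, hall⟩ := hbox ε hε
  obtain ⟨L, hL⟩ := exists_forall_abs_le_of_mem_modulusSet hδW t
  refine ⟨⌈L⌉₊, fun n hn k ↦ ?_⟩
  have ha : L ≤ n := (Nat.le_ceil L).trans (by exact_mod_cast hn)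
  exact measure_exists_lt_abs_drivingFunction_le_of_pairBox (bondPercolation (zdGraph 2) half)
    (hφs k) (bondInterfaceIn D (E (δs k))) (hall k) hL ha

/-- **Registered-shape form** (glue sub-goal `tail_percDrivingTight` of stmt-CriticalPhenomena-0746):
the hypotheses of `Driver.PercDrivingTail D E` verbatim (discretisation family, chordal `φ`,
positive admissible meshes, approximating chordal maps with (U1), (U2), `b_k → b`, box
tightness) imply the UNIFORM TIGHTNESS of the running maxima of the discrete driving processes —
for every `t` and `ε > 0` an `n₀` with
`P_{1/2}{∃ u ≤ t, n < |drivingFunction φ_k (bondInterfaceIn D (E δ_k)) u|} ≤ ε` for all `n ≥ n₀`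
and all `k` (only the chordality of the `φ_k` and box tightness are used).
[cite: KemppainenSmirnov2017, §3.5] -/
theorem tail_percDrivingTight : ∀ (D : DobrushinDomain) (E : ℝ → DiscreteDobrushin), ZdDiscretisationFamily D E → ∀ φ : ConformalEquiv upperHalfPlaneSet D.carrier, D.IsChordalUniformizing φ → ∀ δs : ℕ → ℝ, (∀ k, 0 < δs k) → Tendsto δs atTop (𝓝 0) → (∀ k, (E (δs k)).IsZdAdmissible) → ∀ (Ds : ℕ → DobrushinDomain) (φs : ∀ k, ConformalEquiv upperHalfPlaneSet (Ds k).carrier), (∀ k, (Ds k).IsChordalUniformizing (φs k)) → (∀ R : ℝ, TendstoUniformlyOn (fun k ↦ (φs k).boundaryExtension) φ.boundaryExtension atTop ({z : ℂ | 0 ≤ z.im} ∩ closedBall 0 R)) → (∀ ε : ℝ, 0 < ε → ∃ r : ℝ, ∀ᶠ k in atTop, ∀ z : ℂ, z ∈ {z : ℂ | 0 ≤ z.im} → r ≤ ‖z‖ → dist ((φs k).boundaryExtension z) ((Ds k).pt 1) ≤ ε) → Tendsto (fun k ↦ (Ds k).pt 1) atTop (𝓝 (D.pt 1)) → (∀ ε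 : ℝ≥0∞, 0 < ε → ∃ (δγ δW : ℕ → ℝ) (T : ℕ → ℝ≥0), (∀ j, 0 < δγ j) ∧ (∀ j, 0 < δW j) ∧ ∀ k, bondPercolation (zdGraph 2) half ((bondInterfaceIn D (E (δs k))) ⁻¹' ((fun p ↦ compactifiedClass (φs k).boundaryExtension ((Ds k).pt 1) p.1) '' {p : C(ℝ≥0, ℂ) × C(ℝ≥0, ℝ) | p ∈ generatedPairs ∧ p.1 ∈ Process.modulusSet ({0} : Set ℂ) δγ ∧ p.2 ∈ Process.modulusSet ({0} : Set ℝ) δW ∧ ∀ (j : ℕ) (t : ℝ≥0), T j ≤ t → (j : ℝ) ≤ ‖p.1 t‖})ᶜ) ≤ ε) → ∀ t : ℝ≥0, ∀ ε : ℝ≥0∞, 0 < ε → ∃ n₀ : ℕ, ∀ n : ℕ, n₀ ≤ n → ∀ k : ℕ, bondPercolation (zdGraph 2) half {ω | ∃ u, u ≤ t ∧ (n : ℝ) < |drivingFunction (φs k) (bondInterfaceIn D (E (δs k)) ω) u|} ≤ ε :=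
  fun _ _ _ _ _ _ _ _ _ _ _ hφs _ _ _ hbox t _ hε ↦ percDrivingTight hφs hbox t hε

end Driver

/-! ### The weakest tail clause feeding the `L³` clause of the driver half -/

namespace TailShape

/-- **Summable integer-level tails give the `k`-th moment.** Let `μ` be a finite measure, `f`
a.e.-strongly measurable, and `μ{n < |f|} ≤ B n` for all `n : ℕ` with
`∑ₙ (n+2)^k B n < ∞`. Then `f ∈ L^k(μ)` (pointwise `|f|^k ≤ ∑ₙ (n+2)^k 1{n < |f|}`,
`Process.ofReal_pow_le_tsum_indicator`).  The case `B n = K e^{-cn}` (`n ≥ n₀`) is the tree's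
`Process.memLp_natCast_of_measure_lt_abs_le`. [folklore] -/
theorem memLp_natCast_of_measure_lt_abs_le_of_tsum_ne_top {α : Type*} {m : MeasurableSpace α}
    {μ : Measure α} [IsFiniteMeasure μ] {f : α → ℝ} (hf : AEStronglyMeasurable f μ) {k : ℕ}
    (hk : 1 ≤ k) {B : ℕ → ℝ≥0∞} (hB : ∑' n : ℕ, ((n : ℝ≥0∞) + 2) ^ k * B n ≠ ∞)
    (htail : ∀ n : ℕ, μ {ω | (n : ℝ) < |f ω|} ≤ B n) : MemLp f k μ := by
  -- reduce to a strongly measurable representative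
  set g : α → ℝ := hf.mk f with hg
  have hfg : f =ᵐ[μ] g := hf.ae_eq_mk
  have hgm : Measurable g := hf.stronglyMeasurable_mk.measurable
  suffices hgoal : MemLp g k μ from hgoal.ae_eq hfg.symm
  have htail' : ∀ n : ℕ, μ {ω | (n : ℝ) < |g ω|} ≤ B n := by
    intro n
    have hset : {ω | (n : ℝ) < |g ω|} =ᵐ[μ] {ω | (n : ℝ) < |f ω|} := by
      filter_upwards [hfg] with ω hω
      simp only [eq_iff_iff]
      show (n : ℝ) < |g ω| ↔ (n : ℝ) < |f ω|
      rw [hω]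
    rw [measure_congr hset]
    exact htail n
  refine ⟨hgm.aestronglyMeasurable, ?_⟩
  have hk0 : (k : ℝ≥0∞) ≠ 0 := by exact_mod_cast (Nat.one_le_iff_ne_zero.1 hk)
  rw [eLpNorm_lt_top_iff_lintegral_rpow_enorm_lt_top hk0 (ENNReal.natCast_ne_top k)]
  simp only [ENNReal.toReal_natCast, ENNReal.rpow_natCast]
  have hpt : ∀ ω, ‖g ω‖ₑ ^ k ≤
      ∑' n : ℕ, ((n : ℝ≥0∞) + 2) ^ k * ({ω | (n : ℝ) < |g ω|}.indicator 1 ω) := by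
    intro ω
    have h := Process.ofReal_pow_le_tsum_indicator (abs_nonneg (g ω)) hk
    rw [← Real.enorm_eq_ofReal_abs] at h
    refine h.trans (le_of_eq (tsum_congr fun n ↦ ?_))
    simp only [indicator, mem_setOf_eq, Pi.one_apply]
  have hmeas : ∀ n : ℕ, MeasurableSet {ω | (n : ℝ) < |g ω|} := fun n ↦
    measurableSet_lt measurable_const (continuous_abs.measurable.comp hgm)
  calc ∫⁻ ω, ‖g ω‖ₑ ^ k ∂μ
      ≤ ∫⁻ ω, ∑' n : ℕ, ((n : ℝ≥0∞) + 2) ^ k * ({ω | (n : ℝ) < |g ω|}.indicator 1 ω) ∂μ :=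
        lintegral_mono hpt
    _ = ∑' n : ℕ, ((n : ℝ≥0∞) + 2) ^ k * μ {ω | (n : ℝ) < |g ω|} := by
        rw [lintegral_tsum fun n ↦ ?_]
        · refine tsum_congr fun n ↦ ?_
          rw [lintegral_const_mul _ (measurable_one.indicator (hmeas n)),
            lintegral_indicator_one (hmeas n)]
        · exact (measurable_const.mul (measurable_one.indicator (hmeas n))).aemeasurable
    _ ≤ ∑' n : ℕ, ((n : ℝ≥0∞) + 2) ^ k * B n := ENNReal.tsum_le_tsum fun n ↦ by
        gcongr
        exact htail' n
    _ < ∞ := lt_top_iff_ne_top.2 hB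

variable {ι Ω' : Type*} {Ω : ι → Type*} {mΩ : ∀ i, MeasurableSpace (Ω i)}
  {P : ∀ i, Measure (Ω i)} [∀ i, IsProbabilityMeasure (P i)] {mΩ' : MeasurableSpace Ω'}
  {μ : Measure Ω'} [IsProbabilityMeasure μ] {l : Filter ι}

/-- **The weakest tail clause on the discrete driving processes that feeds the `L^k` clause of
a regular driver** (`IsRegularDriver`, `k = 3`): if continuous-path processes `V^i → W` in
distribution in `C([0, ∞), ℝ)` and, for every integer level `n`, eventually
`P_i{∃ u ≤ t, n < |V^i_u|} ≤ B n` with `∑ₙ (n+2)^k B n < ∞`, then the running maximum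
`M = sup_{u ≤ t} |W_u|` of the limit is in `L^k(μ)` and bounds `|W_u|`, `u ≤ t`, surely
(portmanteau, `Process.measure_lt_comp_le_of_tendstoInDistribution`, and
`memLp_natCast_of_measure_lt_abs_le_of_tsum_ne_top`).  Sub-exponential tails
(`Driver.PercDrivingTail`) are the case `B n = K e^{-r n}`. [folklore] -/
theorem exists_memLp_forall_abs_le_of_tendstoInDistribution_of_tsum_ne_top
    [MeasurableSpace C(ℝ≥0, ℝ)] [OpensMeasurableSpace C(ℝ≥0, ℝ)] [l.NeBot]
    {W : ℝ≥0 → Ω' → ℝ} (hWc : ∀ ω, Continuous (W · ω))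
    {V : ∀ i, ℝ≥0 → Ω i → ℝ} (hVc : ∀ i ω, Continuous (V i · ω))
    (hlaw : TendstoInDistribution (fun i ω ↦ (⟨fun u ↦ V i u ω, hVc i ω⟩ : C(ℝ≥0, ℝ))) l
      (fun ω ↦ (⟨fun u ↦ W u ω, hWc ω⟩ : C(ℝ≥0, ℝ))) P μ)
    (t : ℝ≥0) {k : ℕ} (hk : 1 ≤ k) {B : ℕ → ℝ≥0∞}
    (hB : ∑' n : ℕ, ((n : ℝ≥0∞) + 2) ^ k * B n ≠ ∞)
    (htail : ∀ n : ℕ, ∀ᶠ i in l, P i {ω | ∃ u, u ≤ t ∧ (n : ℝ) < |V i u ω|} ≤ B n) :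
    ∃ M : Ω' → ℝ, MemLp M k μ ∧ (∀ ω, 0 ≤ M ω) ∧ ∀ ω u, u ≤ t → |W u ω| ≤ M ω := by
  haveI := isCompact_iff_compactSpace.1 (isCompact_Icc (a := (0 : ℝ≥0)) (b := t))
  set g : C(ℝ≥0, ℝ) → ℝ := fun w ↦ ‖w.restrict (Icc (0 : ℝ≥0) t)‖ with hgdef
  have hg : Continuous g := Process.continuous_norm_restrict_Icc t
  set pW : Ω' → C(ℝ≥0, ℝ) := fun ω ↦ ⟨fun u ↦ W u ω, hWc ω⟩ with hpW
  refine ⟨fun ω ↦ g (pW ω), ?_, fun ω ↦ norm_nonneg _, fun ω u hu ↦ ?_⟩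
  · refine memLp_natCast_of_measure_lt_abs_le_of_tsum_ne_top
      (hg.measurable.comp_aemeasurable hlaw.aemeasurable_limit).aestronglyMeasurable hk hB
      fun n ↦ ?_
    have hset : {ω | (n : ℝ) < |(g ∘ pW) ω|} = {ω | (n : ℝ) < g (pW ω)} := by
      ext ω
      simp only [mem_setOf_eq, Function.comp_apply, abs_of_nonneg (norm_nonneg _), hgdef]
    rw [hset]
    refine Process.measure_lt_comp_le_of_tendstoInDistribution hlaw hg n ?_
    filter_upwards [htail n] with i hi
    refine le_trans (le_of_eq (congrArg _ ?_)) hi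
    ext ω
    simp only [mem_setOf_eq]
    exact Process.lt_norm_restrict_Icc_iff _ (Nat.cast_nonneg n)
  · exact Process.abs_apply_le_norm_restrict_Icc (pW ω) hu

end TailShape

end Summit.CriticalPhenomena.CardyFormulaZ2.Cruxes.CardyRigidity.CrossingMartingale

end
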